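import Literature.NumberTheory.Automorphic.FixedPointsDoubleCosetUnfolding      -- ★ (F2a) B-p12: `smul_mk_eq_iff'`, the `Σ`-unfolding pattern, `natCard_fixedPoints_eq_finsum`
import Mathlib.GroupTheory.Index
import HarnessLib

/-!
# Fixed points on `H ⧸ M` through a torus double-coset decomposition `H = ⊔ᵢ T rᵢ K` — FLICKER'S COR. 9, COUNTED:
# `#{x ∈ H ⧸ M : t·x = x} = Σᵢ [T : T ∩ rᵢ K rᵢ⁻¹] · #{y ∈ P ⧸ (P ∩ M) : ỹ⁻¹ (rᵢ⁻¹ t rᵢ) ỹ ∈ M}`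
(Flicker, *Elementary proof of the fundamental lemma for a unitary group* (1998), Prop. 6 p. 83, Prop. 8 p. 84, Cor. 9 p. 85)

Topic `NumberTheory/Automorphic`; namespace `Literature.NumberTheory.Automorphic.DoubleCosetFixedPoints` (= ★ (F2a) `FixedPointsDoubleCosetUnfolding`, B-p12).  PURE GROUP
THEORY; theorems only (no definition, no instance, no notation, no named fact, no `sorry`).  Cell `pub/hodgecm-mathlib`, F0∕P3a road «N7-ns COUNT FROM FLICKER» (MAP v3,
architect A-p06 (g26)), brick **(F3c-α)** = the GENERIC half of (F3c) «Prop. 6 ∕ Prop. 8 group forms» (B-p04 (g33), heir of F0P2-p06 (g5); A-p03 (g24) 04:27:59Z: «(C)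
COUNTING SHAPE, AT THE COSET LEVEL» — this file delivers exactly the shape (F3c-C9) of LAYER C, with the frame-specific inputs as HYPOTHESES).  HC_CM is proved only
modulo the printed citations until rung 0 closes; nothing printed is a letter here.

THE MATHEMATICS (measure-free).  `G` a group (model: Flicker's `H = U(1,1) × U(1)`), `t ∈ G`, `T ≤ G` centralising `t` (model: the torus `T_H^θ = Z_H(t)`), subgroups
`K` (model `K_H = H ∩ K₀`), `M ≤ K` (model `H^K_m` — ★ B-p17 (C2): the congruences make `H^K_m` INTEGRAL, so `H^K_m ≤ K_H`), `P ≤ K` (model `P_H·E¹`) with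
`K ⊆ P · M` (Prop. 8 `K_H·E¹ = P_H·H^K_m`), representatives `r : ι → G` with `G = ⊔ᵢ T rᵢ K` (Prop. 6: existence `hA`, disjointness `hB`).  Then, with
`Tᵢ := T ∩ rᵢ K rᵢ⁻¹` (spelled `(K.map (MulAut.conj (r i))).subgroupOf T`) and `τᵢ := rᵢ⁻¹ t rᵢ`:
* §1 `smul_mk_torus_mul_rep_mul_eq_iff` (`t` fixes `τ rᵢ p M ⟺ p⁻¹ τᵢ p ∈ M`) and **`exists_equiv_sigma_prod_fixedPoints`**:
  `Σᵢ (T ⧸ Tᵢ) × {y ∈ P ⧸ (P∩M) : ỹ⁻¹ τᵢ ỹ ∈ M} ≃ {x ∈ G ⧸ M : t·x = x}` via `(i, a, y) ↦ ã rᵢ ỹ M` (`ã, ỹ` = `Quotient.out`) — INJECTIVE because `M ≤ K` makes the index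
  `i` intrinsic (`hB`) and then `rᵢ⁻¹ (ã′⁻¹ ã) rᵢ ∈ K` forces `a = a′`; SURJECTIVE because for `s ∈ Tᵢ` the unit `κ = rᵢ⁻¹ s rᵢ ∈ K` is absorbed by `K ⊆ P·M`.
* §2 **`natCard_fixedPoints_eq_finsum_relIndex_mul`**: `Nat.card {x : G ⧸ M // t • x = x} = ∑ᶠ i, [T : Tᵢ] · Nat.card {y : ↥P ⧸ M.subgroupOf P // ỹ⁻¹ τᵢ ỹ ∈ M}`
  (finitely many fixed points) — Cor. 9's first display with the `m`-sum peeled off by ★ (F2a) `natCard_fixedPoints_eq_finsum`; the weights `[T : Tⱼ] = [R_E^× : R_E(j)^×]`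
  are ★ `UnramifiedQuadraticOrderUnitIndex` ∕ ★ `RamifiedQuadraticOrderUnitIndex` once Prop. 6 (c) identifies `Tⱼ` ((F3c-γ)); `K ⊆ P·M` is Prop. 8 ((F3c-β)).

## References
* [Flicker1998UnitaryFL] Y. Z. Flicker, *Elementary proof of the fundamental lemma for a unitary group*, Canad. J. Math. 50 (1998), Prop. 6 p. 83, Prop. 8 pp. 84–85,
  Cor. 9 p. 85.
-/

set_option autoImplicit false

namespace Literature.NumberTheory.Automorphic

namespace DoubleCosetFixedPoints

variable {G : Type*} [Group G] (T K M P : Subgroup G) {ι : Type*} (r : ι → G) (t : G)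

/-! ## §1 The bijection `Σᵢ (T ⧸ Tᵢ) × {y ∈ P ⧸ P∩M : ỹ⁻¹ τᵢ ỹ ∈ M} ≃ Fix_t(H ⧸ M)` -/

/-- `t` fixes the coset `τ rᵢ p M` (`τ ∈ T` centralising `t`) iff `p⁻¹ (rᵢ⁻¹ t rᵢ) p ∈ M`. [cite: Flicker1998UnitaryFL, Cor. 9 p. 85] -/
theorem smul_mk_torus_mul_rep_mul_eq_iff (ht : ∀ τ ∈ T, τ * t = t * τ) (i : ι) {τ : G} (hτ : τ ∈ T) (p : G) :
    t • (QuotientGroup.mk (τ * r i * p) : G ⧸ M) = QuotientGroup.mk (τ * r i * p) ↔ p⁻¹ * ((r i)⁻¹ * t * r i) * p ∈ M := by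
  rw [smul_mk_eq_iff']
  have e : (τ * r i * p)⁻¹ * t * (τ * r i * p) = p⁻¹ * ((r i)⁻¹ * (τ⁻¹ * t * τ) * r i) * p := by group
  rw [e, show τ⁻¹ * t * τ = t by rw [mul_assoc, ← ht τ hτ, inv_mul_cancel_left]]

/-- **THE TORUS DOUBLE-COSET UNFOLDING OF THE FIXED POINTS ON `H ⧸ M`.**  Let `H = ⊔ᵢ T rᵢ K` (existence `hA`, disjointness `hB`), `T` centralising `t`,
`M ≤ K`, `P ≤ K` with `K ⊆ P · M` (`hKPM`).  Then `(i, τ Tᵢ, p (P∩M)) ↦ τ̃ rᵢ p̃ M` (`τ̃, p̃` the chosen representatives) is a BIJECTION from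
`Σᵢ (T ⧸ Tᵢ) × {y ∈ P ⧸ (P ∩ M) : ỹ⁻¹ (rᵢ⁻¹ t rᵢ) ỹ ∈ M}`, `Tᵢ = T ∩ rᵢ K rᵢ⁻¹`, onto `{x ∈ H ⧸ M : t·x = x}` — the measure-free content of Flicker's
`∫_{T∖H} 1_M(h⁻¹ t h) dh = Σⱼ [T : Tⱼ] · ∫_{P ∕ P∩M} 1_M(p⁻¹ rⱼ⁻¹ t rⱼ p) dp` (Prop. 6 + Prop. 8 ⇒ Cor. 9): `M ≤ K` makes the index `i` of `τ rᵢ k M` intrinsic, and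
for `s ∈ Tᵢ` the element `rᵢ⁻¹ s rᵢ ∈ K` commutes with `rᵢ⁻¹ t rᵢ`. [cite: Flicker1998UnitaryFL, Prop. 6 p. 83; Prop. 8 p. 84; Cor. 9 p. 85] -/
theorem exists_equiv_sigma_prod_fixedPoints (ht : ∀ τ ∈ T, τ * t = t * τ) (hMK : M ≤ K) (hPK : P ≤ K)
    (hKPM : ∀ k ∈ K, ∃ p ∈ P, ∃ x ∈ M, k = p * x)
    (hA : ∀ g : G, ∃ i, ∃ τ ∈ T, ∃ k ∈ K, g = τ * r i * k)
    (hB : ∀ i j, ∀ τ ∈ T, ∀ τ' ∈ T, ∀ k ∈ K, ∀ k' ∈ K, τ * r i * k = τ' * r j * k' → i = j) :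
    Nonempty ((Σ i, (↥T ⧸ (K.map (MulAut.conj (r i)).toMonoidHom).subgroupOf T) ×
        {y : ↥P ⧸ M.subgroupOf P // ((Quotient.out y : ↥P) : G)⁻¹ * ((r i)⁻¹ * t * r i) * (Quotient.out y : ↥P) ∈ M}) ≃
      {x : G ⧸ M // t • x = x}) := by
  classical
  have hTi : ∀ (i : ι) (s : ↥T), s ∈ (K.map (MulAut.conj (r i)).toMonoidHom).subgroupOf T ↔ (r i)⁻¹ * (s : G) * r i ∈ K := by
    intro i s
    rw [Subgroup.mem_subgroupOf, Subgroup.mem_map_equiv]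
    rfl
  -- the map
  let F : (Σ i, (↥T ⧸ (K.map (MulAut.conj (r i)).toMonoidHom).subgroupOf T) ×
        {y : ↥P ⧸ M.subgroupOf P // ((Quotient.out y : ↥P) : G)⁻¹ * ((r i)⁻¹ * t * r i) * (Quotient.out y : ↥P) ∈ M}) →
      {x : G ⧸ M // t • x = x} := fun q =>
    ⟨QuotientGroup.mk (((Quotient.out q.2.1 : ↥T) : G) * r q.1 * ((Quotient.out q.2.2.1 : ↥P) : G)),
      (smul_mk_torus_mul_rep_mul_eq_iff T M r t ht q.1 (Quotient.out q.2.1).2 _).2 q.2.2.2⟩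
  have hF : ∀ q, (F q : G ⧸ M) = QuotientGroup.mk (((Quotient.out q.2.1 : ↥T) : G) * r q.1 * ((Quotient.out q.2.2.1 : ↥P) : G)) := fun _ => rfl
  refine ⟨Equiv.ofBijective F ⟨?_, ?_⟩⟩
  · -- INJECTIVE
    rintro ⟨i, a, ⟨y, hy⟩⟩ ⟨i', a', ⟨y', hy'⟩⟩ hqq
    have h1 := congrArg Subtype.val hqq
    rw [hF, hF] at h1
    simp only at h1
    rw [QuotientGroup.eq] at h1
    -- `τ rᵢ p · m = τ′ rᵢ′ p′`
    set τ : G := ((Quotient.out a : ↥T) : G) with hτ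
    set τ' : G := ((Quotient.out a' : ↥T) : G) with hτ'
    set p : G := ((Quotient.out y : ↥P) : G) with hp
    set p' : G := ((Quotient.out y' : ↥P) : G) with hp'
    set m : G := (τ * r i * p)⁻¹ * (τ' * r i' * p') with hm
    have hrel : τ * r i * (p * m) = τ' * r i' * (p' * 1) := by rw [hm]; group
    obtain rfl : i = i' := hB i i' τ (Quotient.out a).2 τ' (Quotient.out a').2 (p * m) (K.mul_mem (hPK (Quotient.out y).2) (hMK h1))
      (p' * 1) (K.mul_mem (hPK (Quotient.out y').2) K.one_mem) hrel
    -- the `T`-classes agree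
    have hs : (r i)⁻¹ * (τ'⁻¹ * τ) * r i ∈ K := by
      have e : (r i)⁻¹ * (τ'⁻¹ * τ) * r i = (p' * 1) * (p * m)⁻¹ := by
        have := hrel
        calc (r i)⁻¹ * (τ'⁻¹ * τ) * r i = (r i)⁻¹ * τ'⁻¹ * (τ * r i * (p * m)) * (p * m)⁻¹ := by group
          _ = (r i)⁻¹ * τ'⁻¹ * (τ' * r i * (p' * 1)) * (p * m)⁻¹ := by rw [this]
          _ = (p' * 1) * (p * m)⁻¹ := by group
      rw [e]
      exact K.mul_mem (K.mul_mem (hPK (Quotient.out y').2) K.one_mem) (K.inv_mem (K.mul_mem (hPK (Quotient.out y).2) (hMK h1)))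
    have haa : a' = a := by
      rw [← QuotientGroup.out_eq' a, ← QuotientGroup.out_eq' a', QuotientGroup.eq, hTi]
      simpa only [Subgroup.coe_mul, Subgroup.coe_inv] using hs
    subst haa
    -- then `p m = p′`, so the `P ∩ M`-classes agree
    have hpp : p * m = p' := by
      have := hrel
      rw [mul_one] at this
      exact mul_left_cancel this
    have hyy : y = y' := by
      rw [← QuotientGroup.out_eq' y, ← QuotientGroup.out_eq' y', QuotientGroup.eq, Subgroup.mem_subgroupOf, Subgroup.coe_mul, Subgroup.coe_inv]
      rw [← hp, ← hp', ← hpp, inv_mul_cancel_left]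
      exact h1
    subst hyy
    rfl
  · -- SURJECTIVE
    rintro ⟨x, hx⟩
    obtain ⟨g, rfl⟩ := QuotientGroup.mk_surjective x
    obtain ⟨i, τ, hτ, k, hk, rfl⟩ := hA g
    obtain ⟨p, hp, x₁, hx₁, rfl⟩ := hKPM k hk
    -- the chosen representative of `τ Tᵢ` is `τ s`, `s ∈ Tᵢ`
    set a : ↥T ⧸ (K.map (MulAut.conj (r i)).toMonoidHom).subgroupOf T := QuotientGroup.mk ⟨τ, hτ⟩ with ha
    obtain ⟨s, hs⟩ := QuotientGroup.mk_out_eq_mul ((K.map (MulAut.conj (r i)).toMonoidHom).subgroupOf T) (⟨τ, hτ⟩ : ↥T)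
    have hsK : (r i)⁻¹ * ((s : ↥T) : G) * r i ∈ K := (hTi i s).1 s.2
    -- move `κ = rᵢ⁻¹ s rᵢ ∈ K` across: `κ⁻¹ p = p′ x₂`
    obtain ⟨p', hp', x₂, hx₂, hκ⟩ := hKPM (((r i)⁻¹ * ((s : ↥T) : G) * r i)⁻¹ * p) (K.mul_mem (K.inv_mem hsK) (hPK hp))
    set y : ↥P ⧸ M.subgroupOf P := QuotientGroup.mk ⟨p', hp'⟩ with hy
    obtain ⟨m₃, hm₃⟩ := QuotientGroup.mk_out_eq_mul (M.subgroupOf P) (⟨p', hp'⟩ : ↥P)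
    have hm₃M : ((m₃ : ↥P) : G) ∈ M := m₃.2
    -- the key coset identity
    have hcoset : (QuotientGroup.mk (((Quotient.out a : ↥T) : G) * r i * ((Quotient.out y : ↥P) : G)) : G ⧸ M) =
        QuotientGroup.mk (τ * r i * (p * x₁)) := by
      rw [ha, hs, hy, hm₃, QuotientGroup.eq]
      simp only [Subgroup.coe_mul]
      -- `(τ s rᵢ p′ m₃)⁻¹ (τ rᵢ p x₁) ∈ M`, using `κ p′ = p x₂⁻¹`
      have e : (τ * ((s : ↥T) : G) * r i * (p' * ((m₃ : ↥P) : G)))⁻¹ * (τ * r i * (p * x₁)) =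
          ((m₃ : ↥P) : G)⁻¹ * (p'⁻¹ * (((r i)⁻¹ * ((s : ↥T) : G) * r i)⁻¹ * p)) * x₁ := by group
      rw [e, hκ, show p'⁻¹ * (p' * x₂) = x₂ by group]
      exact M.mul_mem (M.mul_mem (M.inv_mem hm₃M) hx₂) hx₁
    have hy' : ((Quotient.out y : ↥P) : G)⁻¹ * ((r i)⁻¹ * t * r i) * (Quotient.out y : ↥P) ∈ M := by
      rw [← smul_mk_torus_mul_rep_mul_eq_iff T M r t ht i (Quotient.out a).2, hcoset]
      exact hx
    exact ⟨⟨i, a, ⟨y, hy'⟩⟩, Subtype.ext (by rw [hF]; exact hcoset)⟩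

/-! ## §2 The count -/

/-- `#(Σᵢ βᵢ) = Σᶠᵢ #βᵢ` for a FINITE sigma type. [folklore] -/
private theorem natCard_sigma_eq_finsum' {α : Type*} (β : α → Type*) [Finite (Σ i, β i)] :
    Nat.card (Σ i, β i) = ∑ᶠ i, Nat.card (β i) := by
  classical
  have hs : (Set.range (Sigma.fst : (Σ i, β i) → α)).Finite := Set.finite_range _
  haveI : ∀ i, Finite (β i) := fun i => Finite.of_injective (fun b : β i => (⟨i, b⟩ : Σ i, β i)) sigma_mk_injective
  haveI : Fintype {i // i ∈ Set.range (Sigma.fst : (Σ i, β i) → α)} := hs.fintype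
  have e : (Σ i : {i // i ∈ Set.range (Sigma.fst : (Σ i, β i) → α)}, β i) ≃ Σ i, β i :=
    Equiv.sigmaSubtypeEquivOfSubset β _ (fun i b => ⟨⟨i, b⟩, rfl⟩)
  have hsupp : Function.support (fun i => Nat.card (β i)) ⊆ Set.range (Sigma.fst : (Σ i, β i) → α) := by
    intro i hi
    obtain ⟨⟨b⟩, -⟩ := Nat.card_ne_zero.1 hi
    exact ⟨⟨i, b⟩, rfl⟩
  rw [← Nat.card_congr e, Nat.card_sigma, finsum_eq_sum_of_support_subset_of_finite _ hsupp hs]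
  exact (Finset.sum_subtype hs.toFinset (fun _ => hs.mem_toFinset) fun i => Nat.card (β i)).symm

/-- **FLICKER'S COROLLARY 9, COUNTED (one `m` at a time):** under `H = ⊔ᵢ T rᵢ K` (`hA`, `hB`), `T` centralising `t`, `M ≤ K`, `P ≤ K`, `K ⊆ P·M`, and finitely many
`t`-fixed points on `H ⧸ M`:
`#{x ∈ H ⧸ M : t·x = x} = Σᶠᵢ [T : T ∩ rᵢ K rᵢ⁻¹] · #{y ∈ P ⧸ (P ∩ M) : ỹ⁻¹ (rᵢ⁻¹ t rᵢ) ỹ ∈ M}` — «`∫_{T∖H} 1_{H^K_m}(h⁻¹th) dh = Σⱼ w(j) ∫_{P_H∕P_H∩H^K_m} 1_{H^K_m}(p⁻¹rⱼ⁻¹trⱼp) dp`»,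
the weights `[T : Tⱼ] = [R_E^× : R_E(j)^×]` being ★ `UnramifiedQuadraticOrderUnitIndex` ∕ `RamifiedQuadraticOrderUnitIndex` once `Tⱼ` is identified (Prop. 6).
[cite: Flicker1998UnitaryFL, Cor. 9 p. 85; Prop. 6 p. 83; Prop. 8 p. 84] -/
theorem natCard_fixedPoints_eq_finsum_relIndex_mul (ht : ∀ τ ∈ T, τ * t = t * τ) (hMK : M ≤ K) (hPK : P ≤ K)
    (hKPM : ∀ k ∈ K, ∃ p ∈ P, ∃ x ∈ M, k = p * x)
    (hA : ∀ g : G, ∃ i, ∃ τ ∈ T, ∃ k ∈ K, g = τ * r i * k)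
    (hB : ∀ i j, ∀ τ ∈ T, ∀ τ' ∈ T, ∀ k ∈ K, ∀ k' ∈ K, τ * r i * k = τ' * r j * k' → i = j)
    (hfin : {x : G ⧸ M | t • x = x}.Finite) :
    Nat.card {x : G ⧸ M // t • x = x} =
      ∑ᶠ i, (K.map (MulAut.conj (r i)).toMonoidHom).relIndex T *
        Nat.card {y : ↥P ⧸ M.subgroupOf P // ((Quotient.out y : ↥P) : G)⁻¹ * ((r i)⁻¹ * t * r i) * (Quotient.out y : ↥P) ∈ M} := by
  obtain ⟨e⟩ := exists_equiv_sigma_prod_fixedPoints T K M P r t ht hMK hPK hKPM hA hB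
  haveI : Finite {x : G ⧸ M // t • x = x} := hfin.to_subtype
  haveI : Finite (Σ i, (↥T ⧸ (K.map (MulAut.conj (r i)).toMonoidHom).subgroupOf T) ×
      {y : ↥P ⧸ M.subgroupOf P // ((Quotient.out y : ↥P) : G)⁻¹ * ((r i)⁻¹ * t * r i) * (Quotient.out y : ↥P) ∈ M}) := Finite.of_equiv _ e.symm
  rw [← Nat.card_congr e, natCard_sigma_eq_finsum']
  refine finsum_congr fun i => ?_
  rw [Nat.card_prod, Subgroup.relIndex, Subgroup.index_eq_card]

end DoubleCosetFixedPoints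

end Literature.NumberTheory.Automorphic
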